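import Literature.Analysis.Fourier.VaalerFunctionIntegralRepresentation
import HarnessLib

/-!
# The derivative `K'` of the Fejér kernel `K(x) = sinc²(πx)` and its Fourier pair
# `K'(y) = ∫ 2πi·u(1−|u|)₊ e^{2πiuy} du`

Support file (theorems only) for Ramaré's approximate formula for `L(1,χ)` with `F₄ = 1 − K`
(odd characters, Acta Arith. 100 (2001), Proposition 2 / Lemma 17), companion of
`VaalerFunctionIntegralRepresentation.lean` (which treats `H = B − K`).  With
`K(x) = sinc²(πx) = 2∫₀¹ (1−t)cos(2πxt) dt` (`two_mul_integral_tent_cos`):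

* `hasDerivAt_sinc_sq` : `K'(x) = −4π∫₀¹ (1−t)t sin(2πxt) dt` (Ramaré's (5.4)), by differentiation
  under the integral sign; `hasDerivAt_sinc_sq_of_ne_zero` : the closed form
  `2 sin(πx)(πx cos(πx) − sin(πx))/(π²x³)` off the origin;
* `abs_sinc_sq_deriv_le` (`|K'| ≤ 3`), `abs_sinc_sq_deriv_le_div_sq` (`|K'(x)| ≤ 1/x²` for `|x| ≥ 1`),
  `abs_sinc_sq_deriv_le_div_one_add_sq` (`|K'(x)| ≤ 6/(1+x²)`), `sinc_sq_deriv_neg` (`K'` is odd);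
* the band-limited Fourier pair (hypothesis `hG : Gc = fun u => if |u| ≤ 1 then 2πi·u(1−|u|) else 0`):
  `continuous_fejerDerivG`, `fejerDerivG_eq_zero` (`|u| ≥ 1`), `fejerDerivG_neg` (odd), and
  `integral_fejerDerivG_mul_cexp` : `∫ G(u)e^{2πiuy}du = K'(y)` — so `(G, K')` satisfies the hypotheses
  of `CompactFourierPoissonTwist.tsum_char_mul_eq_of_bandlimited`.

## References

* O. Ramaré, *Approximate formulae for L(1,χ)*, Acta Arith. 100 (2001) 245–266, (1.10) p. 247,
  §II p. 249, (5.4) p. 260. [cite: Ramare2001LOneApproximateFormulae, (5.4) p. 260]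
-/

noncomputable section

open Real Filter Topology Set MeasureTheory intervalIntegral Complex

namespace Literature.Analysis.Fourier

/-! ## `K'(x) = −4π ∫₀¹ (1−t)t sin(2πxt) dt` -/

/-- **Integral form of `K'`**: the derivative of `x ↦ sinc²(πx) = 2∫₀¹(1−t)cos(2πxt)dt` is
`−4π∫₀¹ (1−t)t sin(2πxt) dt`. [cite: Ramare2001LOneApproximateFormulae, (5.4) p. 260] -/
theorem hasDerivAt_sinc_sq (x₀ : ℝ) :
    HasDerivAt (fun x : ℝ => Real.sinc (π * x) ^ 2)
      (-(4 * π * ∫ t in (0:ℝ)..1, (1 - t) * t * Real.sin (2 * π * x₀ * t))) x₀ := by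
  have hfun : (fun x : ℝ => Real.sinc (π * x) ^ 2) =
      fun x => 2 * ∫ t in (0:ℝ)..1, (1 - t) * Real.cos (2 * π * x * t) :=
    funext fun x => (two_mul_integral_tent_cos x).symm
  rw [hfun]
  set F : ℝ → ℝ → ℝ := fun x t => (1 - t) * Real.cos (2 * π * x * t) with hF
  set F' : ℝ → ℝ → ℝ := fun x t => (1 - t) * (-Real.sin (2 * π * x * t) * (2 * π * t)) with hF'
  have hmeas : ∀ x, AEStronglyMeasurable (F x) (volume.restrict (uIoc (0:ℝ) 1)) := fun x =>
    (by simp only [hF]; fun_prop : Measurable (F x)).aestronglyMeasurable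
  have hmeas' : ∀ x, AEStronglyMeasurable (F' x) (volume.restrict (uIoc (0:ℝ) 1)) := fun x =>
    (by simp only [hF']; fun_prop : Measurable (F' x)).aestronglyMeasurable
  have hint : IntervalIntegrable (F x₀) volume 0 1 :=
    (by simp only [hF]; fun_prop : Continuous (F x₀)).intervalIntegrable 0 1
  have hbound : ∀ᵐ t ∂volume, t ∈ uIoc (0:ℝ) 1 → ∀ x ∈ (univ : Set ℝ), ‖F' x t‖ ≤ 2 * π := by
    refine Eventually.of_forall fun t ht x _ => ?_
    rw [uIoc_of_le zero_le_one] at ht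
    simp only [hF', Real.norm_eq_abs]
    rw [abs_mul, abs_mul, abs_neg]
    have h1 : |1 - t| ≤ 1 := by rw [abs_of_nonneg (by linarith [ht.2])]; linarith [ht.1]
    have h2 : |Real.sin (2 * π * x * t)| ≤ 1 := Real.abs_sin_le_one _
    have h3 : |2 * π * t| ≤ 2 * π := by
      rw [abs_of_nonneg (mul_nonneg (by positivity) ht.1.le)]; nlinarith [ht.2, Real.pi_pos]
    calc |1 - t| * (|Real.sin (2 * π * x * t)| * |2 * π * t|) ≤ 1 * (1 * (2 * π)) := by
          gcongr
      _ = 2 * π := by ring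
  have hderiv : ∀ᵐ t ∂volume, t ∈ uIoc (0:ℝ) 1 → ∀ x ∈ (univ : Set ℝ),
      HasDerivAt (fun x => F x t) (F' x t) x := by
    refine Eventually.of_forall fun t _ x _ => ?_
    simp only [hF, hF']
    have h1 : HasDerivAt (fun x : ℝ => Real.cos (2 * π * x * t))
        (-Real.sin (2 * π * x * t) * (2 * π * t)) x := by
      have := ((hasDerivAt_id x).const_mul (2 * π * t)).cos
      refine (this.congr_deriv ?_).congr_of_eventuallyEq ?_
      · simp only [id]; ring_nf
      · exact Eventually.of_forall fun y => by simp only [id]; ring_nf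
    exact h1.const_mul _
  have key := intervalIntegral.hasDerivAt_integral_of_dominated_loc_of_deriv_le (μ := volume)
    (a := (0:ℝ)) (b := 1) (F := F) (F' := F') (x₀ := x₀) (s := univ) (bound := fun _ => 2 * π)
    univ_mem (Eventually.of_forall hmeas) hint (hmeas' x₀) hbound intervalIntegrable_const hderiv
  have h2 := key.2.const_mul 2
  refine h2.congr_deriv ?_
  rw [show -(4 * π * ∫ t in (0:ℝ)..1, (1 - t) * t * Real.sin (2 * π * x₀ * t))
      = 2 * (-(2 * π) * ∫ t in (0:ℝ)..1, (1 - t) * t * Real.sin (2 * π * x₀ * t)) by ring]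
  congr 1
  rw [← intervalIntegral.integral_const_mul]
  refine intervalIntegral.integral_congr fun t _ => ?_
  simp only [hF']
  ring

/-- `∫₀¹ (1−t)t dt = 1/6`. [folklore] -/
private theorem integral_one_sub_mul_id : ∫ t in (0:ℝ)..1, (1 - t) * t = 1 / 6 := by
  have h1 : ∫ t in (0:ℝ)..1, (1 - t) * t = ∫ t in (0:ℝ)..1, (t - t ^ 2) :=
    intervalIntegral.integral_congr fun t _ => by ring
  rw [h1, intervalIntegral.integral_sub ((by fun_prop : Continuous fun t : ℝ => t).intervalIntegrable _ _)
    ((by fun_prop : Continuous fun t : ℝ => t ^ 2).intervalIntegrable _ _), integral_id, integral_pow]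
  norm_num

/-- `|K'(x)| ≤ 3` for all `x` (indeed `≤ 4π/6`). [cite: Ramare2001LOneApproximateFormulae, (5.4) p. 260] -/
theorem abs_sinc_sq_deriv_le (x : ℝ) :
    |4 * π * ∫ t in (0:ℝ)..1, (1 - t) * t * Real.sin (2 * π * x * t)| ≤ 3 := by
  rw [abs_mul, abs_of_pos (by positivity : (0:ℝ) < 4 * π)]
  have h1 : |∫ t in (0:ℝ)..1, (1 - t) * t * Real.sin (2 * π * x * t)| ≤ ∫ t in (0:ℝ)..1, (1 - t) * t := by
    rw [← Real.norm_eq_abs]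
    refine intervalIntegral.norm_integral_le_of_norm_le zero_le_one
      (Eventually.of_forall fun t ht => ?_)
      ((by fun_prop : Continuous fun t : ℝ => (1 - t) * t).intervalIntegrable _ _)
    rw [Real.norm_eq_abs, abs_mul, abs_of_nonneg (by nlinarith [ht.1, ht.2] : 0 ≤ (1 - t) * t)]
    exact mul_le_of_le_one_right (by nlinarith [ht.1, ht.2]) (Real.abs_sin_le_one _)
  rw [integral_one_sub_mul_id] at h1
  have hπ := Real.pi_lt_d2
  nlinarith [Real.pi_pos]

/-- **Closed form of `K'` off the origin**: `K'(x) = 2 sin(πx)(πx cos(πx) − sin(πx))/(π²x³)`.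
[cite: Ramare2001LOneApproximateFormulae, (5.4) p. 260] -/
theorem hasDerivAt_sinc_sq_of_ne_zero {x : ℝ} (hx : x ≠ 0) :
    HasDerivAt (fun x : ℝ => Real.sinc (π * x) ^ 2)
      (2 * Real.sin (π * x) * (π * x * Real.cos (π * x) - Real.sin (π * x)) / (π ^ 2 * x ^ 3)) x := by
  have hev : (fun y : ℝ => Real.sinc (π * y) ^ 2) =ᶠ[𝓝 x]
      fun y => Real.sin (π * y) ^ 2 / (π ^ 2 * y ^ 2) := by
    filter_upwards [isOpen_ne.mem_nhds hx] with y hy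
    rw [Real.sinc_of_ne_zero (mul_ne_zero Real.pi_ne_zero hy), div_pow, mul_pow]
  rw [hev.hasDerivAt_iff]
  have h1 : HasDerivAt (fun y => Real.sin (π * y)) (Real.cos (π * x) * π) x :=
    ((hasDerivAt_id x).const_mul π |>.sin).congr_deriv (by simp [mul_comm])
  have hd : HasDerivAt (fun y : ℝ => π ^ 2 * y ^ 2) (π ^ 2 * (2 * x)) x := by
    simpa using ((hasDerivAt_pow 2 x).const_mul (π ^ 2))
  have h2 := (h1.fun_pow 2).fun_div hd (by positivity)
  refine h2.congr_deriv ?_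
  field_simp
  ring

/-- **Decay of `K'`**: `|K'(x)| ≤ 1/x²` for `|x| ≥ 1`. [cite: Ramare2001LOneApproximateFormulae, (5.4) p. 260] -/
theorem abs_sinc_sq_deriv_le_div_sq {x : ℝ} (hx : 1 ≤ |x|) :
    |4 * π * ∫ t in (0:ℝ)..1, (1 - t) * t * Real.sin (2 * π * x * t)| ≤ 1 / x ^ 2 := by
  have hx0 : x ≠ 0 := by intro h; rw [h, abs_zero] at hx; linarith
  have huniq := (hasDerivAt_sinc_sq x).unique (hasDerivAt_sinc_sq_of_ne_zero hx0)
  rw [show 4 * π * ∫ t in (0:ℝ)..1, (1 - t) * t * Real.sin (2 * π * x * t)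
      = -(2 * Real.sin (π * x) * (π * x * Real.cos (π * x) - Real.sin (π * x)) / (π ^ 2 * x ^ 3)) by
    linarith, abs_neg]
  have hax : 0 < |x| := by positivity
  have hx3 : |π ^ 2 * x ^ 3| = π ^ 2 * |x| ^ 3 := by
    rw [abs_mul, abs_of_pos (by positivity : (0:ℝ) < π ^ 2), abs_pow]
  rw [abs_div, hx3, div_le_div_iff₀ (by positivity) (by positivity), one_mul]
  have hnum : |2 * Real.sin (π * x) * (π * x * Real.cos (π * x) - Real.sin (π * x))|
      ≤ 2 * (π * |x| + 1) := by
    rw [abs_mul, abs_mul, abs_two]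
    have hs : |Real.sin (π * x)| ≤ 1 := Real.abs_sin_le_one _
    have hc : |π * x * Real.cos (π * x) - Real.sin (π * x)| ≤ π * |x| + 1 := by
      refine (abs_sub _ _).trans ?_
      rw [abs_mul, abs_mul, abs_of_pos Real.pi_pos]
      have h1 := mul_le_mul_of_nonneg_left (Real.abs_cos_le_one (π * x))
        (by positivity : (0:ℝ) ≤ π * |x|)
      have h2 := Real.abs_sin_le_one (π * x)
      linarith
    calc 2 * |Real.sin (π * x)| * |π * x * Real.cos (π * x) - Real.sin (π * x)|
        ≤ 2 * 1 * (π * |x| + 1) := by gcongr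
      _ = 2 * (π * |x| + 1) := by ring
  have hπ3 : 3 < π := Real.pi_gt_three
  have h6 : 3 * 1 ≤ π * |x| := mul_le_mul hπ3.le hx zero_le_one Real.pi_pos.le
  have h5 : 2 * (π * |x| + 1) ≤ π ^ 2 * |x| := by
    nlinarith [mul_nonneg (sub_nonneg.2 h6) (sub_nonneg.2 (show (2:ℝ) ≤ π by linarith))]
  calc |2 * Real.sin (π * x) * (π * x * Real.cos (π * x) - Real.sin (π * x))| * x ^ 2
      ≤ 2 * (π * |x| + 1) * |x| ^ 2 := by
        rw [← sq_abs x]; exact mul_le_mul_of_nonneg_right hnum (by positivity)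
    _ ≤ π ^ 2 * |x| * |x| ^ 2 := mul_le_mul_of_nonneg_right h5 (by positivity)
    _ = π ^ 2 * |x| ^ 3 := by ring

/-- **Uniform decay**: `|K'(x)| ≤ 6/(1 + x²)` for all `x`. [cite: Ramare2001LOneApproximateFormulae, (5.4) p. 260] -/
theorem abs_sinc_sq_deriv_le_div_one_add_sq (x : ℝ) :
    |4 * π * ∫ t in (0:ℝ)..1, (1 - t) * t * Real.sin (2 * π * x * t)| ≤ 6 / (1 + x ^ 2) := by
  rcases le_or_gt 1 |x| with hx | hx
  · refine (abs_sinc_sq_deriv_le_div_sq hx).trans ?_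
    have h1 : 1 ≤ x ^ 2 := by nlinarith [sq_abs x, abs_nonneg x]
    rw [div_le_div_iff₀ (by positivity) (by positivity)]
    nlinarith
  · refine (abs_sinc_sq_deriv_le x).trans ?_
    rw [le_div_iff₀ (by positivity)]
    have : x ^ 2 < 1 := by nlinarith [sq_abs x, abs_nonneg x]
    nlinarith

/-- `K'` is odd. [cite: Ramare2001LOneApproximateFormulae, (5.4) p. 260] -/
theorem sinc_sq_deriv_neg (x : ℝ) :
    4 * π * ∫ t in (0:ℝ)..1, (1 - t) * t * Real.sin (2 * π * (-x) * t)
      = -(4 * π * ∫ t in (0:ℝ)..1, (1 - t) * t * Real.sin (2 * π * x * t)) := by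
  rw [← mul_neg, ← intervalIntegral.integral_neg]
  congr 1
  refine intervalIntegral.integral_congr fun t _ => ?_
  rw [show 2 * π * -x * t = -(2 * π * x * t) by ring, Real.sin_neg]
  ring

/-! ## The Fourier pair `G(u) = 2πi·u(1−|u|)₊ ↔ K'` -/

section Pair

variable {Gc : ℝ → ℂ}

/-- `G` is continuous. [cite: Ramare2001LOneApproximateFormulae, §II p. 249] -/
theorem continuous_fejerDerivG
    (hG : Gc = fun u => if |u| ≤ 1 then (((2 * π * u * (1 - |u|)) : ℝ) : ℂ) * I else 0) :
    Continuous Gc := by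
  subst hG
  refine continuous_if_le continuous_abs continuous_const (by fun_prop) continuousOn_const
    fun y hy => ?_
  rw [hy]; simp

/-- `G(u) = 0` for `|u| ≥ 1`. [cite: Ramare2001LOneApproximateFormulae, §II p. 249] -/
theorem fejerDerivG_eq_zero
    (hG : Gc = fun u => if |u| ≤ 1 then (((2 * π * u * (1 - |u|)) : ℝ) : ℂ) * I else 0)
    {u : ℝ} (hu : 1 ≤ |u|) : Gc u = 0 := by
  subst hG
  simp only
  split_ifs with h
  · have : |u| = 1 := le_antisymm h hu
    rw [this]; simp
  · rfl

/-- `G` is odd. [cite: Ramare2001LOneApproximateFormulae, §II p. 249] -/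
theorem fejerDerivG_neg
    (hG : Gc = fun u => if |u| ≤ 1 then (((2 * π * u * (1 - |u|)) : ℝ) : ℂ) * I else 0)
    (u : ℝ) : Gc (-u) = -Gc u := by
  subst hG
  simp only [abs_neg]
  split_ifs <;> push_cast <;> ring

/-- For `0 ≤ u ≤ 1`: `G(u) = 2πi·u(1−u)`. [cite: Ramare2001LOneApproximateFormulae, §II p. 249] -/
theorem fejerDerivG_eq_of_mem
    (hG : Gc = fun u => if |u| ≤ 1 then (((2 * π * u * (1 - |u|)) : ℝ) : ℂ) * I else 0)
    {u : ℝ} (hu : u ∈ Icc (0:ℝ) 1) : Gc u = ((2 * π * u * (1 - u) : ℝ) : ℂ) * I := by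
  subst hG
  simp only [abs_of_nonneg hu.1, if_pos hu.2]

/-- **The inverse Fourier integral of `G` is `K'`**:
`∫ G(u) e^{2πiuy} du = −4π∫₀¹ (1−t)t sin(2πyt) dt`. [cite: Ramare2001LOneApproximateFormulae, (5.4) p. 260] -/
theorem integral_fejerDerivG_mul_cexp
    (hG : Gc = fun u => if |u| ≤ 1 then (((2 * π * u * (1 - |u|)) : ℝ) : ℂ) * I else 0) (y : ℝ) :
    ∫ u : ℝ, Gc u * cexp (2 * π * I * u * y) =
      ((-(4 * π * ∫ t in (0:ℝ)..1, (1 - t) * t * Real.sin (2 * π * y * t)) : ℝ) : ℂ) := by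
  have hGc := continuous_fejerDerivG hG
  set f : ℝ → ℂ := fun u => Gc u * cexp (2 * π * I * u * y) with hf
  have hfc : Continuous f := by simp only [hf]; fun_prop
  have h1 : ∫ u : ℝ, f u = ∫ u in (-1:ℝ)..1, f u := by
    rw [intervalIntegral.integral_of_le (by norm_num : (-1:ℝ) ≤ 1), ← integral_Icc_eq_integral_Ioc,
      setIntegral_eq_integral_of_forall_compl_eq_zero]
    intro u hu
    simp only [mem_Icc, not_and_or, not_le] at hu
    have : 1 ≤ |u| := by
      rcases hu with h | h
      · rw [abs_of_neg (by linarith)]; linarith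
      · rw [abs_of_pos (by linarith)]; linarith
    simp [hf, fejerDerivG_eq_zero hG this]
  have h2 : ∫ u in (-1:ℝ)..1, f u = ∫ u in (0:ℝ)..1, (f u + f (-u)) := by
    have hneg : ∫ u in (-1:ℝ)..0, f u = ∫ u in (0:ℝ)..1, f (-u) := by
      have := intervalIntegral.integral_comp_neg (a := (0:ℝ)) (b := 1) f
      simp only [neg_zero] at this
      exact this.symm
    have hfn : Continuous fun u : ℝ => f (-u) := hfc.comp' continuous_neg
    rw [← intervalIntegral.integral_add_adjacent_intervals (b := 0)
      (hfc.intervalIntegrable _ _) (hfc.intervalIntegrable _ _), hneg,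
      ← intervalIntegral.integral_add (hfn.intervalIntegrable _ _) (hfc.intervalIntegrable _ _)]
    exact intervalIntegral.integral_congr fun u _ => by ring
  have h3 : ∫ u in (0:ℝ)..1, (f u + f (-u)) = ∫ u in (0:ℝ)..1,
      (((-(4 * π) * ((1 - u) * u * Real.sin (2 * π * y * u))) : ℝ) : ℂ) := by
    refine intervalIntegral.integral_congr fun u hu => ?_
    rw [uIcc_of_le zero_le_one] at hu
    have hev : f u + f (-u) = Gc u * (2 * I * Real.sin (2 * π * u * y)) := by
      simp only [hf, fejerDerivG_neg hG]
      set θ : ℝ := 2 * π * u * y with hθ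
      have e1 : (2 * π * I * u * y : ℂ) = (θ : ℂ) * I := by rw [hθ]; push_cast; ring
      have e2 : (2 * π * I * ((-u : ℝ) : ℂ) * y : ℂ) = ((-θ : ℝ) : ℂ) * I := by
        rw [hθ]; push_cast; ring
      rw [e1, e2, Complex.exp_mul_I, Complex.exp_mul_I]
      push_cast
      rw [Complex.cos_neg, Complex.sin_neg]
      ring
    rw [hev, fejerDerivG_eq_of_mem hG hu]
    push_cast
    rw [show (2 * π * u * y : ℂ) = (2 * π * y * u : ℂ) by ring]
    ring_nf
    rw [Complex.I_sq]
    ring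
  rw [h1, h2, h3, intervalIntegral.integral_ofReal, intervalIntegral.integral_const_mul]
  push_cast
  ring

end Pair

end Literature.Analysis.Fourier
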